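import Literature.Computability.AlgebraicComplexity.OneSliceSpeedup
import Literature.Computability.AlgebraicComplexity.FlatteningBound
import Literature.LinearAlgebra.Matrix.RankInequalities
import Literature.LinearAlgebra.Matrix.FullRankFactorization
import HarnessLib

/-!
# One functional yields a slice `⟨1,t,1⟩` with `t ≥ r − n − m` (Alman–Li 2026, Prop. 5.3)

Topic `Literature/Computability/AlgebraicComplexity` (family `MatrixMultiplication`). Source: J. Alman,
B. Li, *Asymptotic Rank Speedup Theorems, Revisited*, arXiv:2605.21738 (2026), §5.3, Proposition 5.3
with its printed proof (held text `paper:arxiv-2605.21738`, p0013).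

## The printed statement (p0013)

"**Proposition 5.3.** Assume the setting of (thm:freelunch_speedup) [Thm. 5.1: a restriction `T ≤ S`,
`T ∈ U' ⊗ V' ⊗ W'`, `S ∈ U ⊗ V ⊗ W`, given by maps `(A, B, C)`; `C' ⊆ C^⊥`;
`A' = {u ∈ U^∨ : (u ⊗ B ⊗ C') S = 0}`, `B' = {v ∈ V^∨ : (A ⊗ v ⊗ C') S = 0}`;
`T' = (A' ⊗ B' ⊗ C') S`]. Let `C' ⊆ C^⊥` be a one-dimensional subspace spanned by a linear function
`f : W → 𝔽`. Let `r = Rk((id_U ⊗ id_V ⊗ f) S)` be the rank of the resulting matrix in `U ⊗ V`. Then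
we have `T' ≅ ⟨1, t, 1⟩`, where `t ≥ r − n − m`, with `n = dim U'` and `m = dim V'`."

Printed proof: "The restriction `T' = (A' ⊗ B' ⊗ f) S` can be viewed as first contracting the
`W`-mode: `M = (id_U ⊗ id_V ⊗ f) S` yields a matrix of rank `r`. The subspace `A'` is defined as the
kernel of the map `u ↦ (u ⊗ B ⊗ f) S`. Since this map maps to `V'`, its kernel `A'` has codimension
at most `dim V' = m`. Thus, restricting `M` to `A'` reduces the rank by at most `m`. Similarly,
restricting to `B'` reduces the rank by at most `n`. Consequently, `T' = (A' ⊗ B') M` has rank at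
least `t ≥ r − n − m`. A rank-`t` matrix (viewed as a tensor) is isomorphic to `⟨1,t,1⟩`."

## The form proved here (coordinates, as in `AlmanLi2026FreeLunchSpeedup.lean`)

Tensors are `ι → κ → μ → K` (`K` a field); the restriction datum is `A : ι' → ι → K`
(`n = |ι'| = dim U'`), `B : κ' → κ → K` (`m = |κ'| = dim V'`); the functional is `f : μ → K`; the
rows of `A' : α → ι → K`, `B' : β → κ → K` are the chosen vectors of the two annihilator subspaces,
and `T' : α → β → Unit → K`, `T' x y () = ∑_{a,b,c} A'_{xa} B'_{yb} f_c S_{abc}` (the shape of the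
hypothesis `hT'` of `AlmanLi2026.thm51` with `C' = f`, one row).  The slice `⟨1,t,1⟩` with its
trivial factor THIRD is `rotate (oneSliceTensor K (Fin t))` (as in `AlmanLi2026AppendSlice.lean`).

* `AlmanLi2026.prop53_flattening` — "first contracting the `W`-mode": the `α × β` matrix of `T'` is
  `A' · M_f · B'ᵀ` with `(M_f)_{ab} = ∑_c f_c S_{abc}` (every commutative semiring).
* `AlmanLi2026.prop53_rank` — **the rank count**: if the rows of `A'` span (at least) the annihilator
  `{u : (u ⊗ B ⊗ f) S = 0}` and the rows of `B'` span (at least) `{v : (A ⊗ v ⊗ f) S = 0}`, then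
  `r ≤ t + n + m` for `t` = the rank of the matrix of `T'` and `r = rank M_f` — by the codimension
  count of the printed proof (rank–nullity: each annihilator is the kernel of a linear map into an
  `m`- resp. `n`-dimensional space) and Sylvester's rank inequality (tree:
  `Literature.LinearAlgebra.Matrix.rank_add_rank_le_rank_mul_add_card`) applied twice to
  `A' · M_f · B'ᵀ`.  (With bases of the annihilators as rows this is the printed `T'`; larger row
  families are allowed, the bound is the same.)
* `AlmanLi2026.tensorRestrictsTo_of_flattening_rank_eq`,
  `AlmanLi2026.restrictsTo_oneSlice_of_flattening_rank_eq` — "a rank-`t` matrix (viewed as a tensor)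
  is isomorphic to `⟨1,t,1⟩`": both restrictions between `T'` and `rotate (oneSliceTensor K (Fin t))`,
  from a rank factorization `M = G Hᵀ` through `K^t` and one-sided inverses of its full-rank factors
  (tree: `Literature.LinearAlgebra.Matrix.exists_eq_mul_transpose_of_rank_eq`,
  `exists_mul_eq_one_of_rank_eq_card`, `exists_transpose_mul_eq_one_of_rank_eq_card`).
* `AlmanLi2026.prop53` — the printed conclusion packaged: `∃ t, r ≤ t + n + m ∧ T' ≅ ⟨1,t,1⟩`.

Combined with `AlmanLi2026.thm51` (rows of `A'`, `B'` inside the annihilators, `C' = f ∈ C^⊥`) this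
is the one-functional free-lunch speedup `T ⊕ ⟨1,t,1⟩ ⊴ S`, `t ≥ r − n − m`; that one-line
combination is left to a file importing both (this file does not import the companion).
No new definitions, no named facts.

## References

* J. Alman, B. Li, *Asymptotic Rank Speedup Theorems, Revisited*, arXiv:2605.21738 (2026), Prop. 5.3
  and its proof (p0013 of the held text). [AlmanLi2026]
* R. A. Horn, C. R. Johnson, *Matrix Analysis*, 2nd ed. (2013), §0.4.5 (c) (Sylvester's rank
  inequality; tree file `Literature/LinearAlgebra/Matrix/RankInequalities.lean`). [HornJohnson2013]
-/

noncomputable section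

open scoped BigOperators Matrix

namespace Literature.Computability.AlgebraicComplexity

universe u

variable {K : Type u}
variable {ι κ μ ι' κ' α β : Type*}

namespace AlmanLi2026

/-! ## "First contracting the `W`-mode": the matrix of `T'` is `A' · M_f · B'ᵀ` -/

/-- With a single functional `f` in the third factor, the tensor `T' = (A' ⊗ B' ⊗ f) S` (trivial
third index) is, as an `α × β` matrix, the product `A' · M_f · B'ᵀ` with `M_f = (id ⊗ id ⊗ f) S`,
`(M_f)_{ab} = ∑_c f_c S_{abc}` — "first contracting the `W`-mode" (proof of Prop. 5.3); valid over
every commutative semiring. [cite: AlmanLi2026, Prop. 5.3 (proof)] -/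
theorem prop53_flattening [CommSemiring K] [Fintype ι] [Fintype κ] [Fintype μ]
    {S : ι → κ → μ → K} {f : μ → K} {A' : α → ι → K} {B' : β → κ → K} {T' : α → β → Unit → K}
    (hT' : ∀ x y z, T' x y z = ∑ a, ∑ b, ∑ c, A' x a * B' y b * f c * S a b c) :
    (Matrix.of fun x y => T' x y ()) =
      Matrix.of A' * (Matrix.of fun a b => ∑ c, f c * S a b c) * (Matrix.of B')ᵀ := by
  ext x y
  simp only [Matrix.of_apply, hT', Matrix.mul_apply, Matrix.transpose_apply, Finset.sum_mul,
    Finset.mul_sum]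
  rw [Finset.sum_comm]
  refine Finset.sum_congr rfl fun b _ => Finset.sum_congr rfl fun a _ =>
    Finset.sum_congr rfl fun c _ => ?_
  ring

/-! ## The annihilators are kernels of maps into `K^{κ'}`, `K^{ι'}`: codimension ≤ `m`, `n` -/

/-- Rank–nullity for a matrix map `K^ι → K^{κ'}`: `|ι| ≤ dim ker + |κ'|` ("since this map maps to
`V'`, its kernel has codimension at most `dim V' = m`"). [cite: AlmanLi2026, Prop. 5.3 (proof)] -/
private theorem card_le_finrank_ker_add_card [Field K] [Fintype ι] [Fintype κ'] (N : Matrix κ' ι K) :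
    Fintype.card ι ≤ Module.finrank K (LinearMap.ker N.mulVecLin) + Fintype.card κ' := by
  have h1 := LinearMap.finrank_range_add_finrank_ker N.mulVecLin
  rw [Module.finrank_fintype_fun_eq_card] at h1
  have h2 : Module.finrank K (LinearMap.range N.mulVecLin) ≤ Fintype.card κ' :=
    (Submodule.finrank_le _).trans (Module.finrank_fintype_fun_eq_card K).le
  omega

/-- The annihilator `A' = {u ∈ U^∨ : (u ⊗ B ⊗ f) S = 0}` of Thm. 5.1 / Prop. 5.3, as the kernel of
the matrix map `u ↦ (u ⊗ B ⊗ f) S ∈ K^{κ'}`. [cite: AlmanLi2026, Prop. 5.3 (proof)] -/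
theorem mem_ker_annihilatorA_iff [CommSemiring K] [Fintype ι] [Fintype κ] [Fintype μ]
    (S : ι → κ → μ → K) (B : κ' → κ → K) (f : μ → K) (u : ι → K) :
    u ∈ LinearMap.ker (Matrix.of fun (b' : κ') (a : ι) => ∑ b, ∑ c, B b' b * f c * S a b c).mulVecLin
      ↔ ∀ b', (∑ a, ∑ b, ∑ c, u a * B b' b * f c * S a b c) = 0 := by
  have h : ∀ b', (Matrix.of fun (b' : κ') (a : ι) => ∑ b, ∑ c, B b' b * f c * S a b c).mulVec u b'
      = ∑ a, ∑ b, ∑ c, u a * B b' b * f c * S a b c := fun b' => by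
    simp only [Matrix.mulVec, dotProduct, Matrix.of_apply, Finset.sum_mul]
    refine Finset.sum_congr rfl fun a _ => Finset.sum_congr rfl fun b _ =>
      Finset.sum_congr rfl fun c _ => ?_
    ring
  simp only [LinearMap.mem_ker, Matrix.mulVecLin_apply, funext_iff, h, Pi.zero_apply]

/-- The annihilator `B' = {v ∈ V^∨ : (A ⊗ v ⊗ f) S = 0}` of Thm. 5.1 / Prop. 5.3, as the kernel of
the matrix map `v ↦ (A ⊗ v ⊗ f) S ∈ K^{ι'}`. [cite: AlmanLi2026, Prop. 5.3 (proof)] -/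
theorem mem_ker_annihilatorB_iff [CommSemiring K] [Fintype ι] [Fintype κ] [Fintype μ]
    (S : ι → κ → μ → K) (A : ι' → ι → K) (f : μ → K) (v : κ → K) :
    v ∈ LinearMap.ker (Matrix.of fun (a' : ι') (b : κ) => ∑ a, ∑ c, A a' a * f c * S a b c).mulVecLin
      ↔ ∀ a', (∑ a, ∑ b, ∑ c, A a' a * v b * f c * S a b c) = 0 := by
  have h : ∀ a', (Matrix.of fun (a' : ι') (b : κ) => ∑ a, ∑ c, A a' a * f c * S a b c).mulVec v a'
      = ∑ a, ∑ b, ∑ c, A a' a * v b * f c * S a b c := fun a' => by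
    simp only [Matrix.mulVec, dotProduct, Matrix.of_apply, Finset.sum_mul]
    rw [Finset.sum_comm]
    refine Finset.sum_congr rfl fun a _ => Finset.sum_congr rfl fun b _ =>
      Finset.sum_congr rfl fun c _ => ?_
    ring
  simp only [LinearMap.mem_ker, Matrix.mulVecLin_apply, funext_iff, h, Pi.zero_apply]

/-! ## Prop. 5.3: the rank count `t ≥ r − n − m` -/

/-- **Alman–Li 2026, Prop. 5.3 — the rank count**, in coordinates over a field: let `f : μ → K` be a
functional, `M_f = (id ⊗ id ⊗ f) S` (`(M_f)_{ab} = ∑_c f_c S_{abc}`) of rank `r`, let the rows of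
`A' : α → ι → K` span the annihilator `{u : (u ⊗ B ⊗ f) S = 0}` (or any larger family) and the rows
of `B' : β → κ → K` span `{v : (A ⊗ v ⊗ f) S = 0}` (or more), where `A` has `n = |ι'|` rows and `B`
has `m = |κ'|` rows. Then the matrix of `T' = (A' ⊗ B' ⊗ f) S` has rank `t ≥ r − n − m`, i.e.
`r ≤ t + n + m`. Printed proof: codimension of the two kernels ≤ `m`, `n` (rank–nullity), so
restricting `M_f` to them loses rank ≤ `m + n` (Sylvester's inequality, twice).
[cite: AlmanLi2026, Prop. 5.3] -/
theorem prop53_rank [Field K] [Fintype ι] [Fintype κ] [Fintype μ] [Fintype ι'] [Fintype κ']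
    [Fintype α] [Fintype β]
    {S : ι → κ → μ → K} {A : ι' → ι → K} {B : κ' → κ → K} {f : μ → K}
    {A' : α → ι → K} {B' : β → κ → K} {T' : α → β → Unit → K}
    (hT' : ∀ x y z, T' x y z = ∑ a, ∑ b, ∑ c, A' x a * B' y b * f c * S a b c)
    (hA' : ∀ u : ι → K, (∀ b', (∑ a, ∑ b, ∑ c, u a * B b' b * f c * S a b c) = 0) →
      u ∈ Submodule.span K (Set.range A'))
    (hB' : ∀ v : κ → K, (∀ a', (∑ a, ∑ b, ∑ c, A a' a * v b * f c * S a b c) = 0) →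
      v ∈ Submodule.span K (Set.range B')) :
    (Matrix.of fun a b => ∑ c, f c * S a b c).rank ≤
      (Matrix.of fun x y => T' x y ()).rank + Fintype.card ι' + Fintype.card κ' := by
  classical
  -- the two annihilators have codimension ≤ m, n, so the spanning families have large rank
  have hA : Fintype.card ι ≤ (Matrix.of A').rank + Fintype.card κ' := by
    have hc := card_le_finrank_ker_add_card
      (Matrix.of fun (b' : κ') (a : ι) => ∑ b, ∑ c, B b' b * f c * S a b c)
    have hle : LinearMap.ker (Matrix.of fun (b' : κ') (a : ι) =>
        ∑ b, ∑ c, B b' b * f c * S a b c).mulVecLin ≤ Submodule.span K (Set.range A') :=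
      fun u hu => hA' u ((mem_ker_annihilatorA_iff S B f u).1 hu)
    have hmono := Submodule.finrank_mono hle
    have hr : (Matrix.of A').rank = Module.finrank K (Submodule.span K (Set.range A')) :=
      Matrix.rank_eq_finrank_span_row _
    omega
  have hB : Fintype.card κ ≤ (Matrix.of B').rank + Fintype.card ι' := by
    have hc := card_le_finrank_ker_add_card
      (Matrix.of fun (a' : ι') (b : κ) => ∑ a, ∑ c, A a' a * f c * S a b c)
    have hle : LinearMap.ker (Matrix.of fun (a' : ι') (b : κ) =>
        ∑ a, ∑ c, A a' a * f c * S a b c).mulVecLin ≤ Submodule.span K (Set.range B') :=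
      fun v hv => hB' v ((mem_ker_annihilatorB_iff S A f v).1 hv)
    have hmono := Submodule.finrank_mono hle
    have hr : (Matrix.of B').rank = Module.finrank K (Submodule.span K (Set.range B')) :=
      Matrix.rank_eq_finrank_span_row _
    omega
  -- Sylvester's inequality twice on A' · M_f · B'ᵀ
  rw [prop53_flattening hT']
  have h1 := Literature.LinearAlgebra.Matrix.rank_add_rank_le_rank_mul_add_card (Matrix.of A')
    (Matrix.of fun a b => ∑ c, f c * S a b c)
  have h2 := Literature.LinearAlgebra.Matrix.rank_add_rank_le_rank_mul_add_card
    (Matrix.of A' * Matrix.of fun a b => ∑ c, f c * S a b c) (Matrix.of B')ᵀ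
  rw [Matrix.rank_transpose] at h2
  omega

/-! ## "A rank-`t` matrix (viewed as a tensor) is isomorphic to `⟨1,t,1⟩`" -/

/-- A tensor `T'` with trivial third factor whose matrix has rank `t` is a restriction of the slice
`⟨1,t,1⟩` (trivial factor third): from a rank factorization `M = G Hᵀ` through `K^t`,
`T' = (G ⊗ H ⊗ 1) ⟨1,t,1⟩`. [cite: AlmanLi2026, Prop. 5.3 (proof, last sentence)] -/
theorem tensorRestrictsTo_of_flattening_rank_eq [Field K] [Fintype α] [Fintype β] [DecidableEq α]
    [DecidableEq β] (T' : α → β → Unit → K) {t : ℕ}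
    (ht : (Matrix.of fun x y => T' x y ()).rank = t) :
    TensorRestrictsTo (rotate (oneSliceTensor K (Fin t))) T' := by
  obtain ⟨G, H, hGH⟩ :=
    Literature.LinearAlgebra.Matrix.exists_eq_mul_transpose_of_rank_eq _ ht
  refine ⟨fun x i => G x i, fun y j => H y j, fun _ _ => 1, fun x y z => ?_⟩
  have hxy : T' x y z = ∑ i, G x i * H y i := by
    have h := congrFun (congrFun hGH x) y
    simp only [Matrix.of_apply, Matrix.mul_apply, Matrix.transpose_apply] at h
    cases z
    exact h
  rw [hxy]
  simp only [Fintype.sum_unique, rotate_apply, oneSliceTensor_apply, mul_one, mul_ite, mul_zero,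
    Finset.sum_ite_eq, Finset.mem_univ, if_true]

/-- Conversely the slice `⟨1,t,1⟩` is a restriction of such a `T'`: with `M = G Hᵀ` rank revealing,
a left inverse `L G = 1` and a right inverse `Hᵀ R = 1` give `(L ⊗ Rᵀ ⊗ 1) T' = ⟨1,t,1⟩`.
[cite: AlmanLi2026, Prop. 5.3 (proof, last sentence)] -/
theorem restrictsTo_oneSlice_of_flattening_rank_eq [Field K] [Fintype α] [Fintype β]
    [DecidableEq α] [DecidableEq β] (T' : α → β → Unit → K) {t : ℕ}
    (ht : (Matrix.of fun x y => T' x y ()).rank = t) :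
    TensorRestrictsTo T' (rotate (oneSliceTensor K (Fin t))) := by
  obtain ⟨G, H, hGH⟩ :=
    Literature.LinearAlgebra.Matrix.exists_eq_mul_transpose_of_rank_eq _ ht
  have hcard : Fintype.card (Fin t) = (Matrix.of fun x y => T' x y ()).rank := by
    rw [Fintype.card_fin, ht]
  have hG := Literature.LinearAlgebra.Matrix.rank_left_of_eq_mul_transpose hGH hcard
  have hH := Literature.LinearAlgebra.Matrix.rank_right_of_eq_mul_transpose hGH hcard
  obtain ⟨L, hL⟩ := Literature.LinearAlgebra.Matrix.exists_mul_eq_one_of_rank_eq_card hG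
  obtain ⟨R, hR⟩ := Literature.LinearAlgebra.Matrix.exists_transpose_mul_eq_one_of_rank_eq_card hH
  have h1 : L * (Matrix.of fun x y => T' x y ()) * R = 1 := by
    rw [hGH, ← Matrix.mul_assoc L G, hL, Matrix.one_mul, hR]
  refine ⟨fun i x => L i x, fun j y => R y j, fun _ _ => 1, fun i j z => ?_⟩
  have h2 := congrFun (congrFun h1 i) j
  simp only [Matrix.mul_apply, Matrix.of_apply, Matrix.one_apply, Finset.sum_mul] at h2
  simp only [Fintype.sum_unique, rotate_apply, oneSliceTensor_apply, mul_one]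
  rw [← h2, Finset.sum_comm]
  refine Finset.sum_congr rfl fun x _ => Finset.sum_congr rfl fun y _ => ?_
  ring

/-- **Alman–Li 2026, Prop. 5.3**, the printed conclusion packaged: in the setting of `prop53_rank`
(one functional `f`, rows of `A'`, `B'` spanning the two annihilators), `T' ≅ ⟨1,t,1⟩` — each a
restriction of the other — for some `t` with `t ≥ r − n − m` (`r ≤ t + n + m`).
[cite: AlmanLi2026, Prop. 5.3] -/
theorem prop53 [Field K] [Fintype ι] [Fintype κ] [Fintype μ] [Fintype ι'] [Fintype κ']
    [Fintype α] [Fintype β] [DecidableEq α] [DecidableEq β]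
    {S : ι → κ → μ → K} {A : ι' → ι → K} {B : κ' → κ → K} {f : μ → K}
    {A' : α → ι → K} {B' : β → κ → K} {T' : α → β → Unit → K}
    (hT' : ∀ x y z, T' x y z = ∑ a, ∑ b, ∑ c, A' x a * B' y b * f c * S a b c)
    (hA' : ∀ u : ι → K, (∀ b', (∑ a, ∑ b, ∑ c, u a * B b' b * f c * S a b c) = 0) →
      u ∈ Submodule.span K (Set.range A'))
    (hB' : ∀ v : κ → K, (∀ a', (∑ a, ∑ b, ∑ c, A a' a * v b * f c * S a b c) = 0) →
      v ∈ Submodule.span K (Set.range B')) :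
    ∃ t : ℕ, (Matrix.of fun a b => ∑ c, f c * S a b c).rank ≤ t + Fintype.card ι' + Fintype.card κ'
      ∧ TensorRestrictsTo (rotate (oneSliceTensor K (Fin t))) T'
      ∧ TensorRestrictsTo T' (rotate (oneSliceTensor K (Fin t))) :=
  ⟨_, prop53_rank hT' hA' hB', tensorRestrictsTo_of_flattening_rank_eq T' rfl,
    restrictsTo_oneSlice_of_flattening_rank_eq T' rfl⟩

end AlmanLi2026

end Literature.Computability.AlgebraicComplexity
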